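import Mathlib
import Summits.NavierStokesRegularity.NavierStokesRegularity.Theorems.TaoLadderRungTwoBreakBlowupRigidityOneNeverQuiet
import HarnessLib

/-!
# A QUIET INSTANT makes an NS-damped cascade flow (4.5)-regular: the «absorbed state ⇒ regular» packaging of the
  critical-weight fence, for ANY `ν̂`-viscous flow from a one-shell datum (engine of
  `companion_neverQuiet_of_noGlobalCascade`; survival step (E2) of `stub_eternalFromBlowup`, K2(1)
  `TaoLadderRungTwoBreak.BlowupRigidityOne`, stmt-NavierStokesRegularity-20206)

MODEL lattice ODEs only (Tao 2016 §4 Lemma 4.1 (4.5), (4.8), the viscous lattice before Thm. 4.2); nothing here is a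
statement about the Navier–Stokes equations; NO item is closed (`--supports stmt-NavierStokesRegularity-20206`).
General `m`; DEF-FREE.

* `weight45_bounded_of_quietInstant` — if a `ν̂`-viscous flow on `[0,T)` (C¹, one-shell datum, no shells below `0`,
  viscous motion, (4.5)-regular before `T`) has ONE instant `t₁ < T` at which ALL modes satisfy
  `|X_{i,k}(t₁)| ≤ (δ₀/2)(1+ε₀)^{-k/2}`, `δ₀ = ν̂/(2(C_A+1)(1+ε₀)^9)/((8m²+1)(√m+1))`, then the (4.5) norm is bounded on
  `[0,T)`: the critical envelope persists after `t₁` (`criticalEnvelope_persists`, restarted on the clamped translate),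
  holds before `t₁` on the high shells by (4.5)-regularity, and the resulting small critical ceiling on all high shells
  for all times gives (4.5)-boundedness (`weight45_bounded_of_smallCriticalCeiling`, hand 3-g3). So `T` is no blow-up
  time: an absorbed state stays absorbed. (`companion_neverQuiet_of_noGlobalCascade` in `…NeverQuiet` is this lemma
  applied to the maximal companion of a robust blow-up.)

HONEST LABEL: a priori regularity criterion for the damped MODEL lattice; no stub, crux or summit is proved; rung 0.
-/

noncomputable section

-- the summit and its single sub-problem share the name (CONVENTIONS §1)
set_option linter.dupNamespace false

open Set Filter Topology

namespace Summit.NavierStokesRegularity.NavierStokesRegularity.Theorems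

namespace BlowupRigidityOne

open Literature.Analysis.FluidPDE Literature.Analysis.FluidPDE.TaoCascade

variable {m : ℕ}

set_option maxHeartbeats 400000 in
/-- **A QUIET INSTANT MAKES A VISCOUS FLOW (4.5)-REGULAR** (the engine of `companion_neverQuiet_of_noGlobalCascade`,
stated for ANY `ν̂`-viscous flow, not only the maximal companion of a robust blow-up). Let `ε₀ > 0`, `ν̂ > 0`,
`α ∈ E₂(R)`, and let `X` be a `ν̂`-viscous flow on `[0,T)` from the one-shell datum `X₀` (`C¹` on `[0,T)`, datum, no
shells below `0`, viscous motion within `[0,∞)`, (4.5)-regular on every `[0,T']`, `T' < T`). If at some instant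
`t₁ ∈ [0,T)` ALL modes are quiet, `|X_{i,k}(t₁)| ≤ (δ₀/2)(1+ε₀)^{-k/2}` with
`δ₀ = ν̂/(2(C_A+1)(1+ε₀)^9)/((8m²+1)(√m+1))`, then the (4.5) norm stays bounded on `[0,T)` — so `T` is not a blow-up time
and the flow continues (tree continuation criteria). This is the «absorbed state ⇒ regular» packaging of the critical
fence `criticalEnvelope_persists` with `weight45_bounded_of_smallCriticalCeiling`.
[cite: Tao2016AveragedNS, §4 Lemma 4.1 (4.5), (4.8) and the viscous equation before Thm. 4.2; BarbatoMorandinRomito2011, §3.1 Prop. 3.3] -/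
theorem weight45_bounded_of_quietInstant {ε₀ R visc T t₁ : ℝ} (hε : 0 < ε₀) (hvisc : 0 < visc)
    {α : Fin m → Fin m → Fin m → ℤ × ℤ × ℤ → ℝ} {X₀ : Fin m → ℝ} (hα : InTableClass R α)
    {X : Fin m → ℤ → ℝ → ℝ} (hT : 0 < T)
    (h1 : ∀ i n, ContDiffOn ℝ 1 (X i n) (Set.Ico 0 T))
    (h2 : ∀ i n, X i n 0 = if n = 0 then X₀ i else 0)
    (h3 : ∀ i n t, n < 0 → X i n t = 0)
    (h4 : ∀ i n t, 0 ≤ t → t < T → derivWithin (X i n) (Set.Ici 0) t =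
      quadTerm ε₀ α X i n t - visc * (1 + ε₀) ^ ((2 : ℝ) * n) * X i n t)
    (h5 : ∀ T' : ℝ, 0 < T' → T' < T → ∃ M : ℝ, ∀ t : ℝ, 0 ≤ t → t ≤ T' →
      ∀ (i : Fin m) (n : ℤ), (1 + (1 + ε₀) ^ ((10 : ℝ) * n)) * |X i n t| ≤ M)
    (ht₁ : 0 ≤ t₁) (ht₁T : t₁ < T)
    (hquiet : ∀ (i : Fin m) (k : ℤ), |X i k t₁| ≤
      (visc / (2 * (shiftConst α (0, 0, 1) + 1) * (1 + ε₀) ^ 9) /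
          ((8 * (m : ℝ) ^ 2 + 1) * (Real.sqrt m + 1))) / 2 * (1 + ε₀) ^ (-((1 / 2 : ℝ) * k))) :
    ∃ M : ℝ, ∀ t : ℝ, 0 ≤ t → t < T → ∀ (i : Fin m) (n : ℤ),
      (1 + (1 + ε₀) ^ ((10 : ℝ) * n)) * |X i n t| ≤ M := by
  have hb : (0 : ℝ) < 1 + ε₀ := by linarith
  have hb1 : (1 : ℝ) ≤ 1 + ε₀ := by linarith
  -- standard consequences of the maximal-flow clauses (as in `criticalFloor_of_noGlobalCascade`)
  have hder : ∀ i k, ∀ τ ∈ Ico (0 : ℝ) T, HasDerivWithinAt (X i k)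
      (quadTerm ε₀ α X i k τ - visc * (1 + ε₀) ^ ((2 : ℝ) * k) * X i k τ) (Ici 0) τ := by
    intro i k τ hτ
    have hd : DifferentiableWithinAt ℝ (X i k) (Ico 0 T) τ :=
      ((h1 i k).differentiableOn one_ne_zero) τ hτ
    have hd' : DifferentiableWithinAt ℝ (X i k) (Ici 0) τ :=
      hd.mono_of_mem_nhdsWithin (by
        rw [mem_nhdsWithin]
        exact ⟨Iio T, isOpen_Iio, hτ.2, fun x hx => ⟨hx.2, hx.1⟩⟩)
    rw [← h4 i k τ hτ.1 hτ.2]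
    exact hd'.hasDerivWithinAt
  have hreg : ∀ T' : ℝ, T' < T → ∃ M : ℝ, ∀ τ ∈ Icc (0 : ℝ) T', ∀ (i : Fin m) (k : ℤ),
      (1 + (1 + ε₀) ^ ((10 : ℝ) * k)) * |X i k τ| ≤ M := by
    intro T' hT'
    rcases le_or_gt T' 0 with h0 | h0
    · obtain ⟨M, hM⟩ := h5 (T / 2) (by linarith) (by linarith)
      exact ⟨M, fun τ hτ i k => hM τ hτ.1 (by linarith [hτ.2]) i k⟩
    · obtain ⟨M, hM⟩ := h5 T' h0 hT'
      exact ⟨M, fun τ hτ i k => hM τ hτ.1 hτ.2 i k⟩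
  have hamp := viscous_abs_le_datumNorm hε hvisc.le hα.2.1 hder h2 h3 hreg
  have hD : ∀ (k : ℤ) (t : ℝ), 0 ≤ t → t < T → ‖shellVec X k t‖ ≤ Real.sqrt m * Real.sqrt (∑ j, X₀ j ^ 2) :=
    fun k t ht htT => DSSOneShift.norm_shellVec_le_sqrt_mul (Real.sqrt_nonneg _) (fun i => hamp t ⟨ht, htT⟩ i k)
  set B₀ : ℝ := visc / (2 * (shiftConst α (0, 0, 1) + 1) * (1 + ε₀) ^ 9) with hB₀_def
  have hC0 : 0 ≤ shiftConst α (0, 0, 1) := shiftConst_nonneg α _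
  have hB₀ : 0 < B₀ := by positivity
  set δ₀ : ℝ := B₀ / ((8 * (m : ℝ) ^ 2 + 1) * (Real.sqrt m + 1)) with hδ₀_def
  have hden : 0 < (8 * (m : ℝ) ^ 2 + 1) * (Real.sqrt m + 1) := by positivity
  have hδ₀ : 0 < δ₀ := div_pos hB₀ hden
  -- `8 m² δ₀ < visc` and `√m δ₀ ≤ B₀`
  have hB₀le : B₀ ≤ visc / 2 := by
    have : (2 : ℝ) ≤ 2 * (shiftConst α (0, 0, 1) + 1) * (1 + ε₀) ^ 9 := by
      have h9 : (1 : ℝ) ≤ (1 + ε₀) ^ 9 := one_le_pow₀ hb1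
      nlinarith
    rw [hB₀_def]
    exact div_le_div_of_nonneg_left hvisc.le two_pos this
  have hsmall : 8 * (m : ℝ) ^ 2 * 1 * δ₀ < visc := by
    have h1' : 8 * (m : ℝ) ^ 2 * δ₀ ≤ B₀ := by
      rw [hδ₀_def]
      rw [mul_div_assoc']
      rw [div_le_iff₀ hden]
      have hs : 0 ≤ Real.sqrt m := Real.sqrt_nonneg _
      have hP : 0 ≤ B₀ * (8 * (m : ℝ) ^ 2 + 1) * Real.sqrt m :=
        mul_nonneg (mul_nonneg hB₀.le (by positivity)) hs
      nlinarith [hB₀.le, sq_nonneg (m : ℝ), hP]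
    linarith
  have hsqrtδ : Real.sqrt m * δ₀ ≤ B₀ := by
    rw [hδ₀_def, mul_div_assoc', div_le_iff₀ hden]
    have hs : 0 ≤ Real.sqrt m := Real.sqrt_nonneg _
    nlinarith [hB₀.le, sq_nonneg (m : ℝ), mul_nonneg hs (sq_nonneg (m : ℝ))]
  -- the critical ratio `ν = (1+ε₀)^{-1/2}` in the format of `weight45_bounded_of_smallCriticalCeiling`
  set ν : ℝ := (Real.sqrt (1 + ε₀))⁻¹ with hν_def
  have hsq : 0 < Real.sqrt (1 + ε₀) := Real.sqrt_pos.2 hb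
  have hν : 0 < ν := inv_pos.2 hsq
  have hνsq : ν ^ 2 = (1 + ε₀)⁻¹ := by rw [hν_def, inv_pow, Real.sq_sqrt hb.le]
  have hcrit : (1 + ε₀) * ν ^ 2 ≤ 1 := by rw [hνsq, mul_inv_cancel₀ hb.ne']
  have hνpow : ∀ n : ℕ, ν ^ (n : ℤ) = (1 + ε₀) ^ (-((1 / 2 : ℝ) * ((n : ℤ) : ℝ))) := by
    intro n
    rw [zpow_natCast, hν_def, Real.sqrt_eq_rpow, ← Real.rpow_neg hb.le, ← Real.rpow_mul_natCast hb.le]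
    congr 1
    push_cast
    ring
  -- all modes are quiet at `t₁` (hypothesis)
  have hcon := hquiet
  -- table restricted to the shift set: `|α| ≤ 1` everywhere, same nonlinearity
  have hα1 := abs_restrictShiftSet_le zero_le_one (abs_le_one_of_inTableClass hα)
  -- STEP A: the critical envelope `δ₀ (1+ε₀)^{-k/2}` holds at every time `t ∈ [t₁, T)` (fence restarted at `t₁`)
  have hafter : ∀ t, t₁ ≤ t → t < T → ∀ (i : Fin m) (k : ℤ), |X i k t| ≤ δ₀ * (1 + ε₀) ^ (-((1 / 2 : ℝ) * k)) := by
    intro t ht₁t htT i k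
    set s' : ℝ := t - t₁ with hs'
    have hs'0 : 0 ≤ s' := by linarith
    -- the clamped translate `Z τ = X (t₁ + clamp τ)`
    set cl : ℝ → ℝ := fun τ => t₁ + max 0 (min τ s') with hcl
    have hcl_mem : ∀ τ, cl τ ∈ Icc t₁ t := fun τ =>
      ⟨by simp only [hcl]; linarith [le_max_left 0 (min τ s')],
       by simp only [hcl]; linarith [max_le hs'0 (min_le_right τ s')]⟩
    have hcl_id : ∀ τ ∈ Icc 0 s', cl τ = t₁ + τ := fun τ hτ => by
      simp only [hcl, min_eq_left hτ.2, max_eq_right hτ.1]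
    have hcl_cont : Continuous cl := continuous_const.add (continuous_const.max (continuous_id.min continuous_const))
    set Z : Fin m → ℤ → ℝ → ℝ := fun j n τ => X j n (cl τ) with hZ
    obtain ⟨Mt, hMt⟩ := hreg t htT
    have hZenv := criticalEnvelope_persists (α := restrictShiftSet α) (X := Z) (s := s') hε hδ₀ hα1 hsmall hs'0
      (fun j n => by
        have : Z j n 0 = X j n t₁ := by simp only [hZ, hcl, min_eq_left hs'0, max_self, add_zero]
        rw [this]; exact hcon j n)
      ⟨Mt, fun τ j n => hMt (cl τ) ⟨ht₁.trans (hcl_mem τ).1, (hcl_mem τ).2⟩ j n⟩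
      (fun j n => ((h1 j n).continuousOn.comp_continuous hcl_cont fun τ =>
        ⟨ht₁.trans (hcl_mem τ).1, lt_of_le_of_lt (hcl_mem τ).2 htT⟩))
      (fun j n τ hτ => by
        -- derivative of `τ ↦ X (t₁ + τ)` within `Icc 0 s'`, transported to `Z`
        have hmem : t₁ + τ ∈ Ico 0 T := ⟨by linarith [hτ.1], by linarith [hτ.2]⟩
        have hX := hder j n (t₁ + τ) hmem
        have hsh : HasDerivWithinAt (fun σ : ℝ => t₁ + σ) 1 (Icc 0 s') τ := by
          simpa using ((hasDerivAt_id τ).const_add t₁).hasDerivWithinAt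
        have hcomp := hX.comp τ hsh (fun σ hσ => mem_Ici.2 (by linarith [hσ.1]))
        rw [mul_one] at hcomp
        have hcongr : HasDerivWithinAt (Z j n)
            (quadTerm ε₀ α X j n (t₁ + τ) - visc * (1 + ε₀) ^ ((2 : ℝ) * n) * X j n (t₁ + τ)) (Icc 0 s') τ :=
          hcomp.congr (fun σ hσ => by simp only [hZ, hcl_id σ hσ, Function.comp])
            (by simp only [hZ, hcl_id τ hτ, Function.comp])
        have hq : quadTerm ε₀ (restrictShiftSet α) Z j n τ = quadTerm ε₀ α X j n (t₁ + τ) := by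
          rw [quadTerm_restrictShiftSet]
          exact quadTerm_congr_time α (fun j' n' => by simp only [hZ, hcl_id τ hτ]) j n
        have hZτ : Z j n τ = X j n (t₁ + τ) := by simp only [hZ, hcl_id τ hτ]
        rw [hq, hZτ]
        exact hcongr)
    have := hZenv i k s' ⟨hs'0, le_rfl⟩
    have hcls : cl s' = t := by
      rw [hcl_id s' ⟨hs'0, le_rfl⟩, hs']; ring
    have hZs : Z i k s' = X i k t := by
      simp only [hZ]; rw [hcls]
    rwa [hZs] at this
  -- STEP B: before `t₁` the high shells are inside the envelope by (4.5)-regularity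
  obtain ⟨M₁, hM₁⟩ := hreg t₁ ht₁T
  obtain ⟨J, hJ⟩ : ∃ J : ℕ, M₁ ≤ δ₀ * (1 + ε₀) ^ (J : ℝ) := by
    obtain ⟨J, hJ⟩ := pow_unbounded_of_one_lt (M₁ / δ₀) (by linarith : (1 : ℝ) < 1 + ε₀)
    exact ⟨J, by rw [Real.rpow_natCast]; exact ((div_lt_iff₀' hδ₀).1 hJ).le⟩
  have hbefore : ∀ t, 0 ≤ t → t ≤ t₁ → ∀ (i : Fin m) (n : ℕ), J ≤ n →
      |X i (n : ℤ) t| ≤ δ₀ * (1 + ε₀) ^ (-((1 / 2 : ℝ) * ((n : ℤ) : ℝ))) := by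
    intro t ht htt₁ i n hn
    have hw := hM₁ t ⟨ht, htt₁⟩ i n
    have hp10 : 0 < (1 + ε₀) ^ ((10 : ℝ) * ((n : ℤ) : ℝ)) := Real.rpow_pos_of_pos hb _
    have h1' : (1 + ε₀) ^ ((10 : ℝ) * ((n : ℤ) : ℝ)) * |X i n t| ≤ M₁ := by nlinarith [abs_nonneg (X i (n : ℤ) t)]
    have hnr : (J : ℝ) ≤ (n : ℝ) := by exact_mod_cast hn
    have hpJ : 0 < (1 + ε₀) ^ (J : ℝ) := Real.rpow_pos_of_pos hb _
    have hpn : 0 < (1 + ε₀) ^ (-((1 / 2 : ℝ) * ((n : ℤ) : ℝ))) := Real.rpow_pos_of_pos hb _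
    have hsplit2 : (1 + ε₀) ^ ((10 : ℝ) * ((n : ℤ) : ℝ))
        = (1 + ε₀) ^ ((10 : ℝ) * n - (J : ℝ) - (1 / 2 : ℝ) * n) *
          ((1 + ε₀) ^ (J : ℝ) * (1 + ε₀) ^ ((1 / 2 : ℝ) * ((n : ℤ) : ℝ))) := by
      rw [← Real.rpow_add hb, ← Real.rpow_add hb]; congr 1; push_cast; ring
    have hbig2 : 1 ≤ (1 + ε₀) ^ ((10 : ℝ) * n - (J : ℝ) - (1 / 2 : ℝ) * n) :=
      Real.one_le_rpow hb1 (by nlinarith [hnr, (Nat.cast_nonneg J : (0 : ℝ) ≤ J)])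
    have hpn2 : 0 < (1 + ε₀) ^ ((1 / 2 : ℝ) * ((n : ℤ) : ℝ)) := Real.rpow_pos_of_pos hb _
    have h6' : (1 + ε₀) ^ (J : ℝ) * (1 + ε₀) ^ ((1 / 2 : ℝ) * ((n : ℤ) : ℝ)) * |X i n t| ≤ M₁ := by
      calc (1 + ε₀) ^ (J : ℝ) * (1 + ε₀) ^ ((1 / 2 : ℝ) * ((n : ℤ) : ℝ)) * |X i n t|
          = 1 * ((1 + ε₀) ^ (J : ℝ) * (1 + ε₀) ^ ((1 / 2 : ℝ) * ((n : ℤ) : ℝ)) * |X i n t|) := by ring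
        _ ≤ (1 + ε₀) ^ ((10 : ℝ) * n - (J : ℝ) - (1 / 2 : ℝ) * n) *
              ((1 + ε₀) ^ (J : ℝ) * (1 + ε₀) ^ ((1 / 2 : ℝ) * ((n : ℤ) : ℝ)) * |X i n t|) :=
            mul_le_mul_of_nonneg_right hbig2 (by positivity)
        _ = (1 + ε₀) ^ ((10 : ℝ) * ((n : ℤ) : ℝ)) * |X i n t| := by rw [hsplit2]; ring
        _ ≤ M₁ := h1'
    have h7' : (1 + ε₀) ^ ((1 / 2 : ℝ) * ((n : ℤ) : ℝ)) * |X i n t| ≤ δ₀ := by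
      have := h6'.trans hJ
      have h8 : (1 + ε₀) ^ (J : ℝ) * ((1 + ε₀) ^ ((1 / 2 : ℝ) * ((n : ℤ) : ℝ)) * |X i n t|)
          ≤ (1 + ε₀) ^ (J : ℝ) * δ₀ := by rw [← mul_assoc, mul_comm _ δ₀]; exact this
      exact le_of_mul_le_mul_left h8 hpJ
    have hinv : (1 + ε₀) ^ (-((1 / 2 : ℝ) * ((n : ℤ) : ℝ))) * (1 + ε₀) ^ ((1 / 2 : ℝ) * ((n : ℤ) : ℝ)) = 1 := by
      rw [← Real.rpow_add hb, neg_add_cancel, Real.rpow_zero]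
    calc |X i (n : ℤ) t|
        = (1 + ε₀) ^ (-((1 / 2 : ℝ) * ((n : ℤ) : ℝ))) * ((1 + ε₀) ^ ((1 / 2 : ℝ) * ((n : ℤ) : ℝ)) * |X i n t|) := by
          rw [← mul_assoc, hinv, one_mul]
      _ ≤ (1 + ε₀) ^ (-((1 / 2 : ℝ) * ((n : ℤ) : ℝ))) * δ₀ := mul_le_mul_of_nonneg_left h7' hpn.le
      _ = δ₀ * (1 + ε₀) ^ (-((1 / 2 : ℝ) * ((n : ℤ) : ℝ))) := mul_comm _ _
  -- STEP C: a small critical ceiling on the shells `j ≥ J` for ALL times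
  have hceil : ∀ (j : ℤ) (t : ℝ), (J : ℤ) ≤ j → 0 ≤ t → t < T → ‖shellVec X j t‖ ≤ B₀ * ν ^ j := by
    intro j t hj ht htT
    obtain ⟨n, rfl⟩ := Int.eq_ofNat_of_zero_le ((Int.natCast_nonneg J).trans hj)
    have hn : J ≤ n := by exact_mod_cast hj
    have hmode : ∀ i : Fin m, |X i (n : ℤ) t| ≤ δ₀ * (1 + ε₀) ^ (-((1 / 2 : ℝ) * ((n : ℤ) : ℝ))) := by
      intro i
      rcases le_or_gt t t₁ with hle | hgt
      · exact hbefore t ht hle i n hn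
      · exact hafter t hgt.le htT i n
    have hnn : 0 ≤ δ₀ * (1 + ε₀) ^ (-((1 / 2 : ℝ) * ((n : ℤ) : ℝ))) := by positivity
    calc ‖shellVec X (n : ℤ) t‖ ≤ Real.sqrt m * (δ₀ * (1 + ε₀) ^ (-((1 / 2 : ℝ) * ((n : ℤ) : ℝ)))) :=
          DSSOneShift.norm_shellVec_le_sqrt_mul hnn hmode
      _ = (Real.sqrt m * δ₀) * (1 + ε₀) ^ (-((1 / 2 : ℝ) * ((n : ℤ) : ℝ))) := by ring
      _ ≤ B₀ * (1 + ε₀) ^ (-((1 / 2 : ℝ) * ((n : ℤ) : ℝ))) :=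
          mul_le_mul_of_nonneg_right hsqrtδ (Real.rpow_nonneg hb.le _)
      _ = B₀ * ν ^ (n : ℤ) := by rw [hνpow n]
  -- STEP D: (4.5)-boundedness up to `T`, contradicting the blow-up of the maximal companion
  obtain ⟨M, hM⟩ :=
    weight45_bounded_of_smallCriticalCeiling hε hvisc hα.2.1 h1 h2 h3 h4 hD hν hcrit hB₀.le le_rfl hceil
  exact ⟨M, hM⟩

end BlowupRigidityOne

end Summit.NavierStokesRegularity.NavierStokesRegularity.Theorems

end
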